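import Summits.BirchSwinnertonDyer.BirchSwinnertonDyer.Theorems.SmallImageMuTransferMuTransferX9KolyvaginClassTwist
import HarnessLib

/-!
# Route ByReductionTypeAtTwo, crux `OrdKatoHalfAtTwoIso` (stmt-BirchSwinnertonDyer-19573), line `steinberg-fibre-at-two`
# (skeleton v11), stub `stub_coreA_posDisc : CoreTheoremAPosDiscTwo` — plan item (P2) of `STUB-BRIEF-stub_coreA_posDisc.md`,
# GENERIC HEART: the Kolyvagin cocycle of ONE tame prime VANISHES AT AN INVOLUTION lying in the coset `σ^{n/2} N` when
# `4 ∣ n` — i.e. the real component of `κ_q` vanishes for Kolyvagin primes `q ≡ 1 (mod 4)`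

Seat `cruxlead-stmt-BirchSwinnertonDyer-19573-g5` (LEAD PROVER, MODE LINE; HOME `run/shared/lean/pub/bsd-2adic/`; `--supports`
stmt-BirchSwinnertonDyer-19573 as helper). THEOREMS ONLY; generic continuous group cohomology (`X : TopRep R G`, `N ⊴ G`),
curve-free, in the setting and vocabulary of `KolyvaginTwist.exists_kolyvaginCocycle` (`…X9KolyvaginClassTwist.lean`, k6-g3).
HONEST FRAMING (cell bsd-2adic): BSD is not proved by any of this; the crux is not proved; the stub `CoreTheoremAPosDiscTwo`
(p684479) is NOT proved here.

THE POINT. In the Ω road at `p = 2` the sign `Δ < 0` served only to kill the archimedean term of Poitou–Tate through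
`H¹(ℝ, 𝒯_J(E)) = 0`; at `0 < Δ` that group is `𝒯_J(E) ≠ 0` (complex conjugation acts trivially on `E[2]`, p686322) and Step 4
now asks for the real component of the paired Kolyvagin class itself to vanish (`…StepFourOfXInf.lean`, p685843,
hypothesis `hxinf`). The Kolyvagin cocycle `Φ` of a tame prime `q` (prime `ℓ`) is the one of `exists_kolyvaginCocycle`:
`N = Gal(ℚ̄/ℚ(μ_ℓ))`, `σ` a tame generator with `G = ⊔_{i<n} σ^i N`, `n = ℓ − 1`, `σ` acting trivially on `X = 𝒯_J`, `X^N = 0`,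
and `res_N [Φ] = Σ_{i<n} i • σ^i·[y]`. A complex conjugation `c` acts trivially on `𝒯_J(E)` at `0 < Δ`, satisfies `c² = 1`,
and lies in the coset `σ^{n/2} N` (both act as `−1` on `μ_ℓ`). This file proves, purely cohomologically:

* `apply_eq_zero_of_resSubgroup_eq_add_conjMap` — **norm-type classes vanish at the involution**: if `X^N = 0`, `c` acts
  trivially on `X`, `c² = 1`, and `res_N [Φ] = z + c·z` for some class `z ∈ H¹(N, X)`, then `Φ(c) = 0`. (Proof: write
  `Φ|_N = ζ + c·ζ + ∂a` on the nose (`exists_norm_witness_of_sum_conjMap_eq_resSubgroup` with the transversal `{1, c}`);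
  then `c·Φ(c⁻¹uc) − Φ(u) = 0 = u·0 − 0` for all `u ∈ N` because `c⁻¹(c⁻¹uc)c = u`, so the witness lemma
  `Derivative.apply_eq_of_forall_witness` (`X^N = 0`) gives `Φ(c) = 0`.)
* `kolyvaginCocycle_apply_eq_zero_of_even` — **the Kolyvagin cocycle vanishes at `c ∈ σ^k N` when `n = 2k` with `k` EVEN**
  (and `H¹(N, X)` is `2`-torsion, e.g. `2·X = 0`): `Σ_{i<2k} i • σ^i·ξ = D_k ξ + σ^k·D_k ξ + k • σ^k·N_k ξ` with
  `D_k = Σ_{i<k} i • σ^i`, and `k •` kills `2`-torsion, `σ^k· = c·` on `H¹(N, X)` (`N` acts trivially); apply the first lemma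
  with `z = D_k ξ`. For `k` odd (`ℓ ≡ 3 (mod 4)`) the term `σ^k·N_k ξ` survives — hence the restriction to Kolyvagin primes
  `ℓ ≡ 1 (mod 4)` (Rubin's `τ` with `τ·i = i`, p682874) in the brief's (P3).

What is NOT here (next files): `c ∈ σ^{(ℓ−1)/2} N` for a complex conjugation `c` and a tame generator `σ` at `ℓ` (cyclotomic
character: both are `−1` on `μ_ℓ`); the re-export of `exists_kolyvaginCocycle_value_noTransverse` (p661924) with the extra
output `Φ(c) = 0` (it discards `res [Φ]` today); the translation `Φ(c_w) = 0 ⇒ loc_{Sum.inl w} [S^[k] Φ] = 0`.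

References: K. Rubin, *Euler Systems* (2000) §4.4 (Def. 4.4.4, Lemma 4.4.2) [Rubin2000]; B. Perrin-Riou, Ann. Inst. Fourier 48
(1998) §3.1.2 [PerrinRiou1998AIF]; J.-P. Serre, *Local Fields* (1979) VII §5 [SerreLocalFields1979]; tree
`…X9KolyvaginClassTwist.lean` (`exists_kolyvaginCocycle`, `exists_norm_witness_of_sum_conjMap_eq_resSubgroup`),
`GaloisImage/KolyvaginDerivativeCocycleWitnesses.lean` (`apply_eq_of_forall_witness`).
-/

-- the summit and its single problem are both named `BirchSwinnertonDyer` (registry layout D-0017)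
set_option linter.dupNamespace false
set_option autoImplicit false

noncomputable section

open CategoryTheory Function Finset
open Literature.NumberTheory.GaloisRepresentations
open Literature.NumberTheory.EllipticCurves (subgroupConj subgroupConj_apply_coe)
open Summit.BirchSwinnertonDyer.Rank1Residual.GaloisImage
open Summit.BirchSwinnertonDyer.Rank1Residual.GaloisImage.Derivative
open Summit.BirchSwinnertonDyer.Rank1Residual.GaloisImage.Derivative.Transverse

universe u v

namespace Summit.BirchSwinnertonDyer.BirchSwinnertonDyer.Rank1Residual.KolyvaginTwist

variable {R : Type v} [CommRing R] [TopologicalSpace R]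
variable {G : Type u} [Group G] [TopologicalSpace G] [IsTopologicalGroup G]
variable (X : TopRep.{u} R G) (N : Subgroup G) [N.Normal]

/-! ### §1 Norm-type classes vanish at an involution acting trivially -/

/-- `c⁻¹ (c⁻¹ u c) c = u` in `N` when `c² = 1`. [folklore] -/
theorem subgroupConj_subgroupConj_of_mul_self {c : G} (hcc : c * c = 1) (u : N) :
    subgroupConj N c (subgroupConj N c u) = u := by
  have hcinv : c⁻¹ = c := inv_eq_of_mul_eq_one_right hcc
  apply Subtype.ext
  simp only [subgroupConj_apply_coe, hcinv]
  calc c * (c * (u : G) * c) * c = (c * c) * (u : G) * (c * c) := by simp only [mul_assoc]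
    _ = (u : G) := by rw [hcc, one_mul, mul_one]

/-- **Norm-type classes vanish at the involution.** Let `X^N = 0`, let `c ∈ G` act trivially on `X` with `c² = 1`, and let
`Φ` be a continuous cocycle on `G` whose restriction to `N` is, in `H¹(N, X)`, of the form `z + c·z`. Then `Φ(c) = 0`.
(In the application: `N = Gal(ℚ̄/ℚ(μ_ℓ))`, `c` a complex conjugation at `0 < Δ`, `Φ` the Kolyvagin cocycle of a prime
`ℓ ≡ 1 (mod 4)`; then `[Φ]` is locally trivial at the real place.) Proof: `Φ|_N = ζ + c·ζ + ∂a` on the nose; conjugating by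
`c` swaps the two summands (`c⁻¹(c⁻¹uc)c = u`, `c` acts trivially), so `c·Φ(c⁻¹uc) = Φ(u)` for all `u ∈ N`, and the witness
lemma (`X^N = 0`) gives `Φ(c) = 0`. [cite: PerrinRiou1998AIF, §3.1.2] [cite: SerreLocalFields1979, VII §5] -/
theorem apply_eq_zero_of_resSubgroup_eq_add_conjMap
    (h0 : ∀ v : X, (∀ u : N, X.ρ (u : G) v = v) → v = 0)
    (Φ : contOneCocycles X) {c : G} (hc : ∀ w : X, X.ρ c w = w) (hcc : c * c = 1)
    (z : continuousCohomology 1 (subgroupRep X N))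
    (hres : resSubgroup X N 1 (oneCocycleClass X Φ) = z + conjMap X N c 1 z) :
    Φ.1 c = 0 := by
  obtain ⟨ζ, rfl⟩ := oneCocycleClass_surjective _ z
  have hcinv : c⁻¹ = c := inv_eq_of_mul_eq_one_right hcc
  -- the class identity with the transversal `{1, c} = {c^0, c^1}`
  have h' : ∑ i ∈ range 2, conjMap X N (c ^ i) 1 (oneCocycleClass _ ζ) =
      resSubgroup X N 1 (oneCocycleClass X Φ) := by
    rw [Finset.sum_range_succ, Finset.sum_range_one, pow_zero, pow_one, conjMap_one_one, hres]
  -- on the nose: `ζ(u) + c ζ(c⁻¹ u c) = Φ(u) + (u a − a)`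
  obtain ⟨a, ha⟩ := exists_norm_witness_of_sum_conjMap_eq_resSubgroup X N c 2 ζ Φ h'
  have hΦ : ∀ u : N, Φ.1 u = ζ.1 u + ζ.1 (subgroupConj N c u) - (X.ρ (u : G) a - a) := by
    intro u
    have h := ha u
    rw [Finset.sum_range_succ, Finset.sum_range_one, pow_zero, pow_one, map_one, hc] at h
    have h1 : subgroupConj N (1 : G) u = u := Subtype.ext (by simp)
    rw [h1] at h
    -- `h : (1 : _) (ζ.1 u) + ζ.1 (subgroupConj N c u) = Φ.1 u + (X.ρ u a - a)`
    have h2 : ((1 : X →L[R] X) : X → X) (ζ.1 u) = ζ.1 u := rfl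
    rw [h2] at h
    rw [eq_sub_iff_add_eq]
    exact h.symm
  -- the witness computation: `c • Φ(c⁻¹ u c) − Φ(u) = 0 = u • 0 − 0`
  refine apply_eq_of_forall_witness X N h0 Φ c 0 fun u => ?_
  have hρ : X.ρ ((subgroupConj N c u : N) : G) a = X.ρ (u : G) a := by
    rw [subgroupConj_apply_coe, ρ_mul_apply, hc, ρ_mul_apply, hcinv, hc]
  have e : ζ.1 (subgroupConj N c (subgroupConj N c u)) = ζ.1 u := by
    rw [subgroupConj_subgroupConj_of_mul_self N hcc u]
  rw [map_zero, sub_zero, hc, hΦ (subgroupConj N c u), hΦ u, e, hρ]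
  abel

/-! ### §2 The Kolyvagin cocycle vanishes at `c ∈ σ^k N`, `n = 2k`, `k` even -/

/-- **The Kolyvagin cocycle of `exists_kolyvaginCocycle` vanishes at an involution in the coset `σ^k N` when `n = k + k`
with `k` EVEN and `H¹(N, X)` is `2`-torsion.** Data: `X^N = 0`; a cocycle `y` on `N` and a global cocycle `Φ` with
`res_N [Φ] = Σ_{i<k+k} i • σ^i·[y]` (the third output of `exists_kolyvaginCocycle`); `c ∈ G` acting trivially on `X` with
`c² = 1` and `(σ^k)⁻¹ c ∈ N`. Then `Φ(c) = 0`. In the application (`G = Γ_ℚ`, `N = Gal(ℚ̄/ℚ(μ_ℓ))`, `n = ℓ − 1`,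
`X = 𝒯_J(E)` with `2·X = 0`, `c` a complex conjugation at `0 < Δ`): for Kolyvagin primes `ℓ ≡ 1 (mod 4)` the Kolyvagin class
is locally trivial at the real place. Proof: split `Σ_{i<k+k} = Σ_{i<k} + Σ_{i<k}(k+i)·σ^{k+i}`, drop `k • (…)` (`k` even,
`2`-torsion), rewrite `σ^k· = c·` (`N` acts trivially on `H¹(N, X)`), and apply
`apply_eq_zero_of_resSubgroup_eq_add_conjMap` with `z = Σ_{i<k} i • σ^i·[y]`.
[cite: Rubin2000, Def. 4.4.4 and Lemma 4.4.2] [cite: PerrinRiou1998AIF, §3.1.2] -/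
theorem kolyvaginCocycle_apply_eq_zero_of_even
    (h0 : ∀ v : X, (∀ u : N, X.ρ (u : G) v = v) → v = 0)
    (h2 : ∀ η : continuousCohomology 1 (subgroupRep X N), 2 • η = 0)
    {σ : G} {k : ℕ} (hk : Even k)
    (y : contOneCocycles (subgroupRep X N)) (Φ : contOneCocycles X)
    (hres : resSubgroup X N 1 (oneCocycleClass X Φ) =
      ∑ i ∈ range (k + k), i • conjMap X N (σ ^ i) 1 (oneCocycleClass _ y))
    {c : G} (hc : ∀ w : X, X.ρ c w = w) (hcc : c * c = 1) (hcσ : (σ ^ k)⁻¹ * c ∈ N) :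
    Φ.1 c = 0 := by
  set ξ := oneCocycleClass (subgroupRep X N) y with hξ
  -- `c· = σ^k·` on `H¹(N, X)`
  have hck : ∀ η : continuousCohomology 1 (subgroupRep X N),
      conjMap X N c 1 η = conjMap X N (σ ^ k) 1 η := fun η => by
    conv_lhs => rw [show c = σ ^ k * ((σ ^ k)⁻¹ * c) by rw [mul_inv_cancel_left]]
    rw [← conjMap_conjMap, conjMap_eq_self_of_mem_one X N hcσ]
  -- `k •` kills the `2`-torsion group `H¹(N, X)`
  have hkill : ∀ η : continuousCohomology 1 (subgroupRep X N), k • η = 0 := fun η => by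
    obtain ⟨j, rfl⟩ := hk
    rw [add_nsmul, ← two_nsmul, ← mul_nsmul, mul_comm, mul_nsmul, h2, nsmul_zero]
  -- split the derivative sum
  set z : continuousCohomology 1 (subgroupRep X N) := ∑ i ∈ range k, i • conjMap X N (σ ^ i) 1 ξ with hz
  have hsplit : ∑ i ∈ range (k + k), i • conjMap X N (σ ^ i) 1 ξ = z + conjMap X N c 1 z := by
    rw [Finset.sum_range_add, hz]
    congr 1
    rw [hck]
    have hsum : conjMap X N (σ ^ k) 1 (∑ i ∈ range k, i • conjMap X N (σ ^ i) 1 ξ) =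
        ∑ i ∈ range k, i • conjMap X N (σ ^ k) 1 (conjMap X N (σ ^ i) 1 ξ) := by
      rw [map_sum]
      exact Finset.sum_congr rfl fun i _ => map_nsmul _ _ _
    rw [hsum]
    refine Finset.sum_congr rfl fun i _ => ?_
    rw [add_nsmul, hkill, zero_add, pow_add, ← conjMap_conjMap]
  rw [hsplit] at hres
  exact apply_eq_zero_of_resSubgroup_eq_add_conjMap X N h0 Φ hc hcc z hres

end Summit.BirchSwinnertonDyer.BirchSwinnertonDyer.Rank1Residual.KolyvaginTwist

end
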